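import Summits.ValiantsHypothesis.ValiantsHypothesis.Theorems.LacunarySymmetroidMatrixDescartesFiniteSectorDefs

/-!
# `MatrixDescartes` — HEIGHT / PROFILE vocabulary of the full sector (lines «range» and «profile», val-idea-6 g4):
# the height-`H` stamp row, the integer pencil, the quasi-polynomial-height rung and its non-full sector, the design's
# representation numbers, the per-design profile row, the coefficient `ℓ¹`-norm

HONEST FRAMING.  Definitions-only companion (D-0009) — over `…FiniteSectorDefs` (val-sym-eng-3 g3: `pencil`,
`IsFullPosRooted`, `dA5 … dA8b`) — for the Theorems-side port of the two critic-PASSed crux workfiles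
`Cruxes/MatrixDescartes/Lines/range.lean` (val-idea-6 g4 LINE «range»; val-idea-crit-2 VERDICT #26 = PASS, structure +
instrument tier) and `Cruxes/MatrixDescartes/Lines/profile.lean` (LINE «profile»; val-idea-crit-1 VERDICT #24 /
val-idea-crit-2 VERDICT #27 = PASS, same tier).  File split of record (director-valiant g11-R104 (a), val-lit desk
RULING #224): (D) this file (val-port-2) · (R) `…RangeLaw.lean` (range §1–§8, val-port-2) · (P) `…ProfileLaw.lean`
(profile §2–§8, val-port-1) · (§9) the «range» obligations file (val-port-4).  NOTHING is proved or claimed here; the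
two rung-type propositions `HeightMatrixDescartes` / `HeightMDRNonFull` are OPEN obligations of the line, recorded as
`def`s and never asserted.  The crux `Summit.ValiantsHypothesis.ValiantsHypothesis.Theses.LacunarySymmetroid.MatrixDescartes`
(`stmt-ValiantsHypothesis-18050`) is height-free and asymptotic in `K`; this vocabulary is height-sensitive and lives on
the FULL (stamp) sector; nothing here bears on the crux, on Conjecture B (`KPlusLogSqLaw`) or on `VP ≠ VNP`.

Texts are the workfiles' VERBATIM (namespace moved from `Theses.…RangeLine` / `Theses.…ProfileLine` into the sector
namespace `…Theorems.LacunarySymmetroidMatrixDescartes.FiniteSector`, `pencil` / `IsFullPosRooted` resolved to the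
`…FiniteSectorDefs` declarations instead of the workfiles' local copies).
* `HeightStampLawAt m K H B` («range» §5): the height-`H` stamp row «`ν_H(m,K) ≤ B`».
* `pencilZ`, `castZ` («range» §6): the integer pencil and the realification of integer letters.
* `HeightMatrixDescartes` («range» §7, RUNG, open): the crux restricted to letters of quasi-polynomial height with
  integer-like ends `|trailing·leading| ≥ 1` — a CONSEQUENCE of the crux (drop two hypotheses), not crux-sufficient.
* `HeightMDRNonFull` («range» §8, open): the same on the NON-full sector (the full sector is a theorem of (R)).
* `Rrep d m r` («profile» §0): ordered `m`-fold representation number of `r` by the exponent design `d`.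
* `ProfileRow d H n` («profile» §6): per-design row — no full `2×2` pencil on `d` with letters `≤ H`, `|c₀·lc| ≥ 1`,
  degree `n`.
* `l1 q` («range» §9): coefficient `ℓ¹`-norm, for the obligations file.
[folklore] Elementary real-polynomial / additive-combinatorics vocabulary; the two open propositions are statements of
the cell's line «range» (val-idea-6 g4), no citation exists.
-/

-- `Summit.ValiantsHypothesis.ValiantsHypothesis.…` repeats a component by the D-0017 layout
-- (single-conjunct summit), which the `dupNamespace` linter flags; the name is mandated.
set_option linter.dupNamespace false

noncomputable section

namespace Summit.ValiantsHypothesis.ValiantsHypothesis.Theorems.LacunarySymmetroidMatrixDescartes.FiniteSector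

open scoped BigOperators Matrix
open Polynomial

/-- **Height-`H` stamp row** «`ν_H(m,K) ≤ B`» (line «range» §5, verbatim): every full-positive-rooted `(m,K)` pencil
with letters bounded by `H` and integer-like normalisation `|c₀ · lc| ≥ 1` (automatic for integer letters with
`det ≢ 0`) has degree `≤ B`.  Decided by `m!·(K H)^m < 2^{B+1}` in (R). [folklore] -/
def HeightStampLawAt (m K : ℕ) (H : ℝ) (B : ℕ) : Prop :=
  ∀ (d : Fin K → ℕ) (S : Fin K → Matrix (Fin m) (Fin m) ℝ), (∀ l i j, |S l i j| ≤ H) →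
    1 ≤ |(pencil d S).det.coeff 0 * (pencil d S).det.leadingCoeff| →
    IsFullPosRooted (pencil d S).det → (pencil d S).det.natDegree ≤ B

/-- The INTEGER lacunary pencil `Σ_l X^{d_l} Z_l ∈ M_m(ℤ[X])` (line «range» §6, verbatim). [folklore] -/
abbrev pencilZ {m K : ℕ} (d : Fin K → ℕ) (Z : Fin K → Matrix (Fin m) (Fin m) ℤ) :
    Matrix (Fin m) (Fin m) ℤ[X] :=
  ∑ l, ((Polynomial.X : ℤ[X]) ^ d l) • (Z l).map Polynomial.C

/-- Realification of integer letters, `l ↦ (Z l).map Int.cast` (line «range» §6, verbatim), so that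
`pencil d (castZ Z)` is the real pencil with integer letters. [folklore] -/
abbrev castZ {m K : ℕ} (Z : Fin K → Matrix (Fin m) (Fin m) ℤ) : Fin K → Matrix (Fin m) (Fin m) ℝ :=
  fun l => (Z l).map (Int.cast : ℤ → ℝ)

/-- **RUNG «height-MDR»** (line «range» §7, verbatim; OPEN obligation of the line, recorded as a proposition and never
asserted): the crux `MatrixDescartes` restricted to letters of quasi-polynomial height `|S_l i j| ≤ 2^{(⌊log₂K⌋+c)^c}`
with the integer-like normalisation `|trailing · leading| ≥ 1` — a CONSEQUENCE of the crux (drop the two extra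
hypotheses), NOT crux-sufficient (the theta witnesses need doubly-exponential height); its FULL sector is a theorem
of (R) (`heightMDR_fullSector`), so it reduces to `HeightMDRNonFull`.
[statement of the cell's line «range» (val-idea-6 g4); no citation exists] -/
def HeightMatrixDescartes : Prop :=
  ∀ c q : ℕ, 0 < q → ∃ K₀ : ℕ, ∀ K m : ℕ, K₀ ≤ K → m ≤ 2 ^ ((Nat.log 2 K + c) ^ c) →
    ∀ (d : Fin K → ℕ) (S : Fin K → Matrix (Fin m) (Fin m) ℝ), (∀ l, (S l).IsSymm) →
      (∀ l i j, |S l i j| ≤ (2:ℝ) ^ ((Nat.log 2 K + c) ^ c)) →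
      1 ≤ |(pencil d S).det.trailingCoeff * (pencil d S).det.leadingCoeff| →
      (pencil d S).det.roots.toFinset.card ^ q ≤ 2 ^ (K * Nat.log 2 K)

/-- **Obligation «height-MDR, non-full sector»** (line «range» §8, verbatim; OPEN, recorded as a proposition and never
asserted): the rung for pencils whose determinant is NOT full-positive-rooted (some degree is spent on non-positive or
non-real roots, or on multiplicity).  (R) proves `HeightMDRNonFull → HeightMatrixDescartes`.
[statement of the cell's line «range» (val-idea-6 g4); no citation exists] -/
def HeightMDRNonFull : Prop :=
  ∀ c q : ℕ, 0 < q → ∃ K₀ : ℕ, ∀ K m : ℕ, K₀ ≤ K → m ≤ 2 ^ ((Nat.log 2 K + c) ^ c) →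
    ∀ (d : Fin K → ℕ) (S : Fin K → Matrix (Fin m) (Fin m) ℝ), (∀ l, (S l).IsSymm) →
      (∀ l i j, |S l i j| ≤ (2:ℝ) ^ ((Nat.log 2 K + c) ^ c)) →
      1 ≤ |(pencil d S).det.trailingCoeff * (pencil d S).det.leadingCoeff| →
      ¬ IsFullPosRooted (pencil d S).det →
      (pencil d S).det.roots.toFinset.card ^ q ≤ 2 ^ (K * Nat.log 2 K)

/-- Ordered `m`-fold **representation number** of `r` by the exponent design `d` (line «profile» §0, verbatim):
`R_d^{(m)}(r) = #{λ : Fin m → Fin K | Σ_i d(λ i) = r} = [t^r] (Σ_l t^{d_l})^m`. [folklore] -/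
def Rrep {K : ℕ} (d : Fin K → ℕ) (m r : ℕ) : ℕ :=
  (Finset.univ.filter (fun lam : Fin m → Fin K => (∑ i, d (lam i)) = r)).card

/-- **Profile row schema** (line «profile» §6, verbatim): on design `d`, no full `2×2` pencil with letters `≤ H` and
`|c₀·lc| ≥ 1` has degree `n`.  (P) derives it from one thin window `(r, R(r), R(n−r))` with
`C(n,r)² > 4·H⁴·R(r)·R(n−r)`. [folklore] -/
def ProfileRow {K : ℕ} (d : Fin K → ℕ) (H : ℝ) (n : ℕ) : Prop :=
  ∀ S : Fin K → Matrix (Fin 2) (Fin 2) ℝ, (∀ l i j, |S l i j| ≤ H) →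
    1 ≤ |(pencil d S).det.coeff 0 * (pencil d S).det.leadingCoeff| →
    IsFullPosRooted (pencil d S).det → (pencil d S).det.natDegree ≠ n

/-- Coefficient `ℓ¹`-norm `‖q‖₁ = Σ_{r ≤ deg q} |q_r|` (line «range» §9, verbatim; for the obligations file). [folklore] -/
def l1 (q : ℝ[X]) : ℝ := ∑ r ∈ Finset.range (q.natDegree + 1), |q.coeff r|

end Summit.ValiantsHypothesis.ValiantsHypothesis.Theorems.LacunarySymmetroidMatrixDescartes.FiniteSector

end
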